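import Literature.MathematicalPhysics.QuantumFieldTheory.Balaban1983to89.Node00.MultiScaleFibreChart
import Literature.MathematicalPhysics.QuantumFieldTheory.Balaban1983to89.B7BlockAvgLog
import Literature.MathematicalPhysics.QuantumFieldTheory.Balaban1983to89.Node00.Record11
import Summits.QuantumFields.YangMills.Theorems.BalabanUVNodesK0Stub1FlatChartDImplicit
import Summits.QuantumFields.YangMills.Theorems.BalabanUVNodesK0Stub1FlatAveragingDictionary
import HarnessLib

/-!
# N07 [B11] ∕ K0⁷ road, chart side — MODULE 108: **THE HEAD TOKEN's POTENTIAL IS HERMITIAN-TRACELESS WHERE THE GAUGE EQUATION HOLDS** — `U^u(b) = e^{iηA(b)}` with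
# `‖iηA(b)‖ < log 2` and `U^u(b)` in the log chart of `SU(N)` ⇒ `iη·A(b) ∈ 𝔰𝔲(N)` (repair (R3)(j)); AND `Q_V(H_V B) = B` FOR THE HEAD TOKEN's PLAIN MATRIX KERNELS, so `A₁ = X − H_V Q_V X`
# is blind to adding `H_V B` (repair (R3)(i)) — the two algebraic letters of the (d′) conclusion transfer (⚑ LOCATED-DPRIME-CALIBRATION, ROADMAP §5)

Cell `pub-ymgap`, seat `pub-ymgap-dag-n07-e` g29 (FAN-OUT §N07 row s3; LANE OWNER of the K0 road chart side), MODULE 108 (`DPRIME-LAM-ROADMAP.md` §5 (j)).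
`--kind proof --supports stmt-QuantumFields-20541 --as helper` (K0⁷); count-neutral; theorems only.  [15] = [Balaban1985Variational]; [I] = [Balaban1987RG1]; [3] = [Balaban1985Averaging].

WHY.  S4(-Lam) reads the charted configuration through `X : PBond → lieSU` (`⇑X = iη·A′`); the head token (MODULE 100 :149–152) only says `gaugeU (ιSU u) (ιSU U) b = expI η (A b)` on the
tower.  By the tree's log chart of `SU(N)` (`Node00.MultiScaleFibreChart.mlog_mem_lieSU_of_mem_SU`, [3] (21)) and `mlog ∘ exp = id` below `log 2` (`B7BlockAvgLog.mlog_exp`),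
`iη·A(b) = mlog(U^u(b)) ∈ 𝔰𝔲(N)` wherever the equation holds and the two smallness letters are available (they are: (T2) and the class (2)).

WHAT IS PROVED (sorry-free; no definition; axioms standard).  §1 `coe_expI_eq_exp` (`↑(expI η a) = exp((iη)•a)`, `rfl`); ★★ `I_eta_smul_mem_lieSU_of_expI_eq` (the statement above for
one bond: `↑(ιSU g) = ↑(expI η a)`, `‖(iη)•a‖ < log 2`, `‖g − 1‖ ≤ rhoSU N` ⟹ `(iη)•a ∈ lieSU (Fin N)`).  §2 ((R3)(i)) ★★ `QV_HV_eq` (S4's `QV` letter = `bondAvgIter` of the matrix field is CITED: k0-s1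
`K0Stub1FlatAveragingDictionary.QV_apply_eq_bondAvgIter`; `Q_V(H_V B) = B` for the head token's plain kernels — k0-s1-w4 `bondAvgIter_flatH` + UST `bondAvgIter_kernel_apply`), ★ `sub_HV_QV_add_HV_eq`
(`(X + H_V B) − H_V Q_V(X + H_V B) = X − H_V Q_V X`).
HONEST FRAMING: two lines over the tree's log chart; NOTHING of [15]'s estimates asserted; (d′) ∕ `HThm4RecDbar` ∕ budget row of MODULE 100 untouched; K0⁷ NOT closed; N07 NOT
discharged; counts unmoved; one finite 𝕋⁴ programme at fixed ε — NOT continuum ∕ ℝ⁴ ∕ OS ∕ mass gap ∕ Clay.  No `sorry`, no `def`, no `instance`, no `notation`.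

References: [15] (152) p.301, (159) p.303; [3] (21) p.21; [I] (1.13) p.262.
-/

set_option autoImplicit false

noncomputable section

open scoped Matrix.Norms.L2Operator

namespace Summit.QuantumFields.YangMills.BalabanUVNodes.N07DPrimeHermitianLetter

open Literature.MathematicalPhysics.QuantumFieldTheory.Balaban1983to89
open Literature.MathematicalPhysics.QuantumFieldTheory.Balaban1983to89.Node00
open Literature.MathematicalPhysics.QuantumFieldTheory.Balaban1983to89.B12RegularSpaces111 (expI)
open MatrixLog (mlog)
open T4AdjointCovarianceUnitary (lieSU)

variable {N : ℕ}

/-- `↑(expI η a) = exp((iη)•a)` (definitional). [cite: Balaban1987RG1, (1.13) p.262 (bookkeeping)] -/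
theorem coe_expI_eq_exp (η : ℝ) (a : MatA N) : ((expI η a : (MatA N)ˣ) : MatA N) = NormedSpace.exp ((Complex.I * (η : ℂ)) • a) := rfl

variable [NeZero N]

/-- ★★ **A SMALL POTENTIAL READ BY AN `SU(N)` UNIT THROUGH `e^{iηa}` IS `𝔰𝔲`-VALUED AFTER MULTIPLICATION BY `iη`**: `↑(ιSU g) = ↑(expI η a)`, `‖(iη)•a‖ < log 2` and `g` in the log
chart (`‖g − 1‖ ≤ rhoSU N`) give `(iη)•a = mlog g ∈ lieSU (Fin N)` — so `a` is Hermitian and traceless when `η ≠ 0`. [cite: Balaban1985Averaging, (21) p.21; Balaban1985Variational, (152) p.301, (159) p.303] -/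
theorem I_eta_smul_mem_lieSU_of_expI_eq (η : ℝ) (a : MatA N) (g : SU N)
    (h : ((ιSU N g : (MatA N)ˣ) : MatA N) = ((expI η a : (MatA N)ˣ) : MatA N))
    (hsmall : ‖(Complex.I * (η : ℂ)) • a‖ < Real.log 2) (hρ : ‖((g : SU N) : MatA N) - 1‖ ≤ rhoSU N) :
    (Complex.I * (η : ℂ)) • a ∈ lieSU (Fin N) := by
  have h1 : mlog ((g : SU N) : MatA N) ∈ lieSU (Fin N) := mlog_mem_lieSU_of_mem_SU g.2 hρ
  have h2 : ((g : SU N) : MatA N) = NormedSpace.exp ((Complex.I * (η : ℂ)) • a) := by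
    rw [← coe_ιSU N g, h]; rfl
  rw [h2, B7BlockAvgLog.mlog_exp hsmall] at h1
  exact h1

/-! ## §2  `Q_V(H_V B) = B` for the head token's plain matrix kernels, and `A₁` is blind to `H_V B` ((R3)(i)) -/

section Transfer

open Literature.MathematicalPhysics.QuantumFieldTheory.Balaban1983to89.B6SectADomainsV1 (Domains)
open Literature.MathematicalPhysics.QuantumFieldTheory.Balaban1983to89.B6SectAOperatorsV1 (BondIdx QE)
open LatticeFieldCalculus (bondAvgIter)
open Summit.QuantumFields.YangMills.Theorems.K0FlatCubeOpsTextP (flatH)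
open Summit.QuantumFields.YangMills.Theorems.K0Stub1FlatChartDImplicit (bondAvgIter_flatH)
open Summit.QuantumFields.YangMills.Theorems.ChartHInv (bondAvgIter_kernel_apply)
open Summit.QuantumFields.YangMills.Theorems (K0Stub1FlatAveragingDictionary.QV_apply_eq_bondAvgIter)

variable {P : Params} (k : ℕ) (D : Domains P)

omit [NeZero N] in
/-- ★★ **`Q_V(H_V B) = B`** for the head token's plain kernels `H_V Bf b = Σ_c flatH(𝟙_c)(b) • Bf c` ([15] (45) `QH = 1`: UST `QE_hOp` read through the kernels, k0-s1-w4's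
`bondAvgIter_flatH` + UST `bondAvgIter_kernel_apply`). [cite: Balaban1985Variational, (45) p.285; Balaban1984PropagatorsII, (2.35) p.228] -/
theorem QV_HV_eq
    (QV : (PBond P 0 → Matrix (Fin N) (Fin N) ℂ) →ₗ[ℂ] (BondIdx D → Matrix (Fin N) (Fin N) ℂ))
    (hQV : ∀ (A : PBond P 0 → Matrix (Fin N) (Fin N) ℂ) (t : BondIdx D),
      QV A t = ∑ j, ((WithLp.ofLp (QE D (WithLp.toLp 2 (Pi.single j 1))) t : ℝ) : ℂ) • A j)
    (HV : (BondIdx D → Matrix (Fin N) (Fin N) ℂ) →ₗ[ℂ] (PBond P 0 → Matrix (Fin N) (Fin N) ℂ))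
    (hHV : ∀ (Bf : BondIdx D → Matrix (Fin N) (Fin N) ℂ) (b : PBond P 0), HV Bf b = ∑ c, ((flatH P k D (Pi.single c 1) b : ℝ) : ℂ) • Bf c)
    (Bf : BondIdx D → Matrix (Fin N) (Fin N) ℂ) : QV (HV Bf) = Bf := by
  classical
  funext t
  rw [K0Stub1FlatAveragingDictionary.QV_apply_eq_bondAvgIter D hQV]
  have hHX : (HV Bf : PBond P 0 → Matrix (Fin N) (Fin N) ℂ) = fun b => ∑ s, (flatH P k D (Pi.single s 1) b) • Bf s := by
    funext b; rw [hHV Bf b]; exact Finset.sum_congr rfl fun s _ => by rw [Complex.coe_smul]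
  rw [hHX, bondAvgIter_kernel_apply (fun b s => flatH P k D (Pi.single s 1) b) Bf (t.1.1 : ℕ) t.1.2]
  have hker : ∀ s : BondIdx D, bondAvgIter (t.1.1 : ℕ) (fun b => flatH P k D (Pi.single s 1) b) t.1.2 = (Pi.single s (1 : ℝ) : BondIdx D → ℝ) t :=
    fun s => bondAvgIter_flatH k D _ t
  simp_rw [hker]
  rw [Finset.sum_eq_single t (fun s _ hs => by rw [Pi.single_eq_of_ne (Ne.symm hs), zero_smul]) (fun h => absurd (Finset.mem_univ t) h),
    Pi.single_eq_same, one_smul]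

omit [NeZero N] in
/-- ★ **`A₁` IS BLIND TO `H_V B`**: `(X + H_V B) − H_V(Q_V(X + H_V B)) = X − H_V(Q_V X)` — the conclusion of the supplier at the chart parameter `A′ = Ã + H·Z` reads at `Ã`.
[cite: Balaban1985Variational, (159) p.303, (45) p.285] -/
theorem sub_HV_QV_add_HV_eq
    (QV : (PBond P 0 → Matrix (Fin N) (Fin N) ℂ) →ₗ[ℂ] (BondIdx D → Matrix (Fin N) (Fin N) ℂ))
    (hQV : ∀ (A : PBond P 0 → Matrix (Fin N) (Fin N) ℂ) (t : BondIdx D),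
      QV A t = ∑ j, ((WithLp.ofLp (QE D (WithLp.toLp 2 (Pi.single j 1))) t : ℝ) : ℂ) • A j)
    (HV : (BondIdx D → Matrix (Fin N) (Fin N) ℂ) →ₗ[ℂ] (PBond P 0 → Matrix (Fin N) (Fin N) ℂ))
    (hHV : ∀ (Bf : BondIdx D → Matrix (Fin N) (Fin N) ℂ) (b : PBond P 0), HV Bf b = ∑ c, ((flatH P k D (Pi.single c 1) b : ℝ) : ℂ) • Bf c)
    (X : PBond P 0 → Matrix (Fin N) (Fin N) ℂ) (Bf : BondIdx D → Matrix (Fin N) (Fin N) ℂ) :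
    (X + HV Bf) - HV (QV (X + HV Bf)) = X - HV (QV X) := by
  rw [map_add, QV_HV_eq k D QV hQV HV hHV, map_add]
  abel

end Transfer

end Summit.QuantumFields.YangMills.BalabanUVNodes.N07DPrimeHermitianLetter

end
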